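import Summits.Ventures.PercRepro.S3SixWindow
import Summits.Ventures.PercRepro.RankLevelSetLevelSixRowsNineToFifteen

/-!
# PercRepro — S3 HOLDS: THE `q = 6` WINDOW OF C-025 IS EMPTY (p8 g17, S3 owner)

The sub-claim S3 of the crux of record — `S3Window : ∀ {α} (M : Matroid α) [M.Finite] (p : ℕ), 8 ≤ p → p ≤ 124425 → ThmN.RLS M p 6`
(S3SixWindow, the typed `Prop` of the ACCELERATION table) — is a theorem of the tree: every `p` of the window is covered by the
whole level-`6` row `ThmN.c025_six_all (8 ≤ p)` (RankLevelSetLevelSixRowsNineToFifteen: the rows `15 … 9` of p7 g22's feeder on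
p8's `16` row, the row `8` of night-4), which needs no upper bound on `p` at all. Hence the `q = 6` row of `C025` holds for every
finite matroid and every `p ≥ 8 = q + 2` — stated once more in the set-builder vocabulary of `C025` (`c025_six_row_all`).
Axioms: standard.
-/

open scoped Matroid

namespace PercRepro

/-- **S3 HOLDS**: `C025` at level `6` for every finite matroid and every `8 ≤ p ≤ 124425`. -/
theorem s3Window_holds : S3Window :=
  fun M _ p hp _ => ThmN.c025_six_all M p hp

/-- **THE WHOLE `q = 6` ROW OF `C025`** in the set-builder vocabulary of `C025`: for every finite matroid `M` and every `p ≥ 8`,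
`Φ(p, 6) · #{A ⊆ E : ρ(A) = p, ρ(E ∖ A) = 6} ≤ #{A ⊆ E : 6 < ρ(A) < p}`. -/
theorem c025_six_row_all {α : Type} (M : Matroid α) [M.Finite] (p : ℕ) (hp : 8 ≤ p) :
    phiK p 6 * ({A : Set α | A ⊆ M.E ∧ M.eRk A = (p : ℕ∞) ∧ M.eRk (M.E \ A) = (6 : ℕ∞)}.ncard : ℚ) ≤
      ({A : Set α | A ⊆ M.E ∧ (6 : ℕ∞) < M.eRk A ∧ M.eRk A < (p : ℕ∞)}.ncard : ℚ) :=
  c025_six_row_of_s3Window' s3Window_holds M p hp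

end PercRepro
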